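import Literature.AlgebraicGeometry.Frobenioids.Thm34Sub
import Literature.AlgebraicGeometry.Frobenioids.EquivalenceThm34ivClosed
import HarnessLib

/-!
# Frobenioids I, Theorem 3.4 sub-DAG: closers of `Thm34Sub` slots, tranche 3 — Theorem 3.4 (iv) assembly

Mochizuki, *The geometry of Frobenioids I*, Kyushu J. Math. **62** (2008), Thm. 3.4 (iv) pp. 62–63
[cite: MochizukiFrdI2008, Thm. 3.4 (iv) p.63].

PROOF-ONLY file (abc-iut-L1-d8 = writer of the `Thm34Sub` closers). Tranche 3 closes the assembly
`Thm34iv_FSM` (preservation part of Thm. 3.4 (iv) over FSM-type bases: `Ψ` preserves `O^▷(−)`, `O^×(−)`, and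
`Ψ^{ℕ_{≥1}} = id`) and the slot `L09_PsiN_Identity`, both by abc-iut-w4-d093's capstone
`FrdI.thm34iv_ofFunctor_of_isOfFSMType` (p414314; ingredients abc-iut-w4-d033 p412709, abc-iut-L1-t13 p410831,
abc-iut-w4-d088, w4-d093 p413680/p413130/p412372). The slot `L08_UnitsDivisorsPreserved` is closed directly by
w4-d093's `FrdI.l08_unitsDivisorsPreserved` (p413680) and is not restated here.
-/

namespace Literature.AlgebraicGeometry.Frobenioids

namespace FrdI

namespace Thm34Sub

open CategoryTheory PreFrobenioidData

universe w v v' u u'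

variable {D₁ : Type u} [Category.{v} D₁] {Φ₁ : D₁ᵒᵖ ⥤ CommMonCat.{w}} {C₁ : Type u'} [Category.{v'} C₁]
  {D₂ : Type u} [Category.{v} D₂] {Φ₂ : D₂ᵒᵖ ⥤ CommMonCat.{w}} {C₂ : Type u'} [Category.{v'} C₂]
  (F₁ : C₁ ⥤ ElemFrobenioid Φ₁) (F₂ : C₂ ⥤ ElemFrobenioid Φ₂) (Ψ : C₁ ≌ C₂)

/-- **Thm. 3.4 (iv) over FSM-type bases — CLOSED** (`Thm34iv_FSM`): under (a) standard type, (b), Frobenioids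
over FSM-type bases and (c) `D₁, D₂` Frobenius-slim, `Ψ` preserves `O^▷(−)`, `O^×(−)` and Frobenius degrees
(abc-iut-w4-d093 `FrdI.thm34iv_ofFunctor_of_isOfFSMType`). [cite: MochizukiFrdI2008, Thm. 3.4 (iv) p.63] -/
theorem thm34iv_FSM_holds : Literature.AlgebraicGeometry.Frobenioids.FrdI.Thm34Sub.Thm34iv_FSM F₁ F₂ Ψ :=
  fun h hs₁ hs₂ =>
    FrdI.thm34iv_ofFunctor_of_isOfFSMType h.isFrobenioid₁ h.isFrobenioid₂ h.fsm₁ h.fsm₂ Ψ h.standard₁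
      h.standard₂ h.hypB hs₁ hs₂

/-- `Thm34iv_FSM` — `_holds` alias of `thm34iv_FSM_holds` above under the fact's exact name (appended
2026-08-28, D-0026 bookkeeping: the proof term is the existing theorem of this file; no statement,
definition or attribute is edited; no new named fact; the ledger's debt table listed the fact
unproved). [cite: MochizukiFrdI2008, Thm. 3.4 (iv) p.63] -/
theorem _root_.Literature.AlgebraicGeometry.Frobenioids.FrdI.Thm34Sub.Thm34iv_FSM_holds :
    Literature.AlgebraicGeometry.Frobenioids.FrdI.Thm34Sub.Thm34iv_FSM F₁ F₂ Ψ :=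
  _root_.Literature.AlgebraicGeometry.Frobenioids.FrdI.Thm34Sub.thm34iv_FSM_holds (F₁ := F₁) (F₂ := F₂) (Ψ := Ψ)

/-- **SLOT (iv)/L09 `PsiN_Identity` — CLOSED** (both halves: `Ψ^{ℕ_{≥1}} = id` under (a)(b)(c) over
FSM-type bases). [cite: MochizukiFrdI2008, Thm. 3.4 (iv) p.63] -/
theorem l09_psiN_identity_holds :
    Literature.AlgebraicGeometry.Frobenioids.FrdI.Thm34Sub.L09_PsiN_Identity F₁ F₂ Ψ :=
  fun h hs₁ hs₂ => (thm34iv_FSM_holds F₁ F₂ Ψ h hs₁ hs₂).2.2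

end Thm34Sub

end FrdI

end Literature.AlgebraicGeometry.Frobenioids
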